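import Literature.Computability.AlgebraicComplexity.LMR13PLambdaStabilizerBlockI
import Literature.Computability.AlgebraicComplexity.LMR13PLambdaStabilizerBlockII
import Literature.Computability.AlgebraicComplexity.SkewPairingInvolutions
import HarnessLib

/-!
# LMR13 §3.5, the stabiliser of `P_Λ`: block (III) — the skew part of `L_X` on `Λ²` is killed by the `n²`
# functionals `Φ, Ψ` (elementary route to (X3b), memo §5)

[topic Computability/AlgebraicComplexity]

Landsberg–Manivel–Ressayre 2013, §3.5 (journal p. 481; arXiv:1004.4802 `p0008.txt:L74–94`) assert that the
stabiliser of the boundary form `P_Λ(A + S) = (1/n)·tr(adj(A)·S)` inside `𝔤𝔩(M_n)` is "isomorphic with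
`𝔤𝔩_n ⊕ 𝔤𝔩_n`. In particular it has dimension `2n²`" (`LMR2013_prop_3_5_1`, OPEN in the tree for `n > 3`;
`n = 3` is `LMR2013_prop_3_5_1_three`). In the elementary route of the val-lit cell (memo
`HOME/lmr/X3b-ELEMENTARY-ROUTE-t10g4.md`; split `pLambda_glAnn_blocks`, `LMR13PLambdaStabilizerSplit.lean`) an
annihilating `X ∈ glAnn (pLambda n)` acts by `(L_X W)_{kl} = Σ_p X_{p,(k,l)} W_p`, and the `S`-degree-one part of
`X·P_Λ = 0` is the pointwise identity

  (III)  `tr(adj(A)·β(S)) + tr(D(A, α(A))·S) = 0`   (`A` skew, `S` symmetric),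

with `α(W) := ½(L_X W − (L_X W)ᵀ)`, `β(W) := ½(L_X W + (L_X W)ᵀ)`, `D = SkewAdj.adjDeriv`. This file proves, for
`n = h + h + 1 ≥ 5`, that **(III) together with the vanishing of the `n²` coordinate functionals**
`Φ_{ra} := β(E_ra + E_ar)_{rr}` (`r ≠ a`) and `Ψ := (α(E_0j − E_j0)_{0j})_{j ≠ 0}, α(E_12 − E_21)_{12}` **forces
`α(A) = 0` for every skew `A`** (`skewPart_linAct_skew_eq_zero`, stated in the cell's agreed interface), and
records the consequence `tr(adj(A)·β(S)) = 0` (`trace_adjugate_mul_symPart_linAct_eq_zero_of_blockIII`) from which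
the `β`-half follows by the rank-one test `adj(A(Ω,y)) = det Ω·yyᵀ` (separate file). Steps (memo §5, with `Φ = 0`
used from the start so that the memo's `w_r` vanish):

* `blockIII_row_padAt_eq_zero`: at `R₀ = R_r(Ω)` (`Ω` invertible skew), testing (III) with `S = E_rk + E_kr` and
  `Φ = 0` gives `D(R₀, α R₀)_{rk} = 0`, hence (row formula `adjDeriv_padAt_row_vecMul`) row `r` of `α(R₀)` is `0`;
* `blockIII_row_wedge_eq_zero` (pair-differences of `J(π,s)`, `SkewPairingMatrices.lean`): row/column `r` of
  `α(e_a∧e_b)` vanish for `r ∉ {a,b}`, so (`blockIII_hadamard`) **`α` is a Hadamard multiplier on `Λ²`**: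
  `α(E)_{kl} = a'_{kl}·E_{kl}` with `a'_{kl} := α(e_k∧e_l)_{kl}` symmetric;
* `blockIII_sum_pairs_eq`: testing (III) at `R_r(J(π,s))` with `S = E_rr` (Jacobi `adjDeriv_padAt_apply_self`)
  gives `Σ_x a'_{x̄, π̄x} = −β(E_rr)_{rr}` for EVERY fixed-point-free involution `π` of the indices `≠ r`;
* `blockIII_exchange`: two involutions differing by an exchange (`SkewPairingInvolutions.lean`) give
  `a'_{ab} + a'_{cd} = a'_{ac} + a'_{bd}` for distinct `a,b,c,d` (a fifth index `r` exists as `n ≥ 5`);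
* `blockIII_skewPart_eq_zero`: with `Ψ = 0` the exchange relations force `a' = 0`, hence `α = 0` on `Λ²`.

The abstract statements take `(α, β)` as plain functions with the identity (III) as a hypothesis; the last section
instantiates them with `L_X` for `X ∈ glAnn (pLambda (h+h+1))` via `pLambda_glAnn_blocks`.

Everything is PROVED; theorems only; no named fact, no definition. Honest framing: this is one block of an
elementary proof of `finrank (glAnn P_Λ) ≤ 2n² − 1` being assembled by the cell; `LMR2013_prop_3_5_1` remains OPEN
in the tree for `n > 3`; VP ≠ VNP is NOT proved and nothing here is progress on that separation.

## References

* [LandsbergManivelRessayre2013] J. M. Landsberg, L. Manivel, N. Ressayre, *Hypersurfaces with degenerate duals and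
  the geometric complexity theory program*, Comment. Math. Helv. 88 (2013) 469–484, §3.5 (p. 481).
-/

noncomputable section

open Matrix

namespace Literature.Computability.AlgebraicComplexity

namespace SkewAdj

/-! ### Small matrix identities -/

section Small

variable {ι : Type*} [Fintype ι] [DecidableEq ι]

/-- `tr(M·E_ij) = M_ji`. [cite: LandsbergManivelRessayre2013, §3.5 (p. 481)] -/
theorem trace_mul_single_one (M : Matrix ι ι ℂ) (i j : ι) :
    Matrix.trace (M * Matrix.single i j (1 : ℂ)) = M j i := by
  rw [Matrix.trace_mul_comm, Matrix.trace_single_mul, smul_eq_mul, one_mul]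

omit [Fintype ι] [DecidableEq ι] in
/-- The skew part `½(M − Mᵀ)` is skew. [cite: LandsbergManivelRessayre2013, §3.5 (p. 481)] -/
theorem transpose_half_smul_sub_transpose (M : Matrix ι ι ℂ) :
    ((1 / 2 : ℂ) • (M - Mᵀ))ᵀ = -((1 / 2 : ℂ) • (M - Mᵀ)) := by
  rw [Matrix.transpose_smul, Matrix.transpose_sub, Matrix.transpose_transpose, ← smul_neg, neg_sub]

/-- A skew matrix is the signed half-sum of its entries against the wedges `E_ab − E_ba`.
[cite: LandsbergManivelRessayre2013, §3.5 (p. 481)] -/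
theorem skew_eq_half_sum_wedge {E : Matrix ι ι ℂ} (hE : Eᵀ = -E) :
    E = (1 / 2 : ℂ) • ∑ p : ι × ι, E p.1 p.2 • (Matrix.single p.1 p.2 (1 : ℂ) - Matrix.single p.2 p.1 1) := by
  ext a b
  have hba : E b a = -E a b := by
    have h1 := congrFun (congrFun hE a) b
    rwa [Matrix.transpose_apply, Matrix.neg_apply] at h1
  have h1 : ∀ p : ι × ι, p ≠ (a, b) → Matrix.single p.1 p.2 (1 : ℂ) a b = 0 := by
    intro p hp
    refine Matrix.single_apply_of_ne _ _ _ _ _ ?_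
    rintro ⟨h1, h2⟩
    exact hp (Prod.ext h1 h2)
  have h2 : ∀ p : ι × ι, p ≠ (b, a) → Matrix.single p.2 p.1 (1 : ℂ) a b = 0 := by
    intro p hp
    refine Matrix.single_apply_of_ne _ _ _ _ _ ?_
    rintro ⟨h1, h2⟩
    exact hp (Prod.ext h2 h1)
  rw [Matrix.smul_apply, Matrix.sum_apply]
  simp only [Matrix.smul_apply, Matrix.sub_apply, smul_eq_mul, mul_sub, Finset.sum_sub_distrib]
  rw [Finset.sum_eq_single (a, b) (fun p _ hp => by rw [h1 p hp, mul_zero])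
      (fun h => absurd (Finset.mem_univ _) h),
    Finset.sum_eq_single (b, a) (fun p _ hp => by rw [h2 p hp, mul_zero])
      (fun h => absurd (Finset.mem_univ _) h)]
  simp only [Matrix.single_apply_same, mul_one, hba]
  ring

/-- **Hadamard form.** If `α` is additive and homogeneous with skew values, and every row `r ∉ {a,b}` of
`α(E_ab − E_ba)` vanishes, then on skew matrices `α` is entrywise multiplication by `a'_{kl} := α(E_kl − E_lk)_{kl}`:
`α(E)_{kl} = a'_{kl}·E_{kl}`. [cite: LandsbergManivelRessayre2013, §3.5 (p. 481)] -/
theorem hadamard_of_rows_eq_zero (α : Matrix ι ι ℂ → Matrix ι ι ℂ)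
    (hadd : ∀ S T, α (S + T) = α S + α T) (hsmul : ∀ (c : ℂ) S, α (c • S) = c • α S)
    (hskew : ∀ W, (α W)ᵀ = -α W)
    (hrow : ∀ a b r : ι, a ≠ b → r ≠ a → r ≠ b → ∀ j,
      α (Matrix.single a b (1 : ℂ) - Matrix.single b a 1) r j = 0)
    {E : Matrix ι ι ℂ} (hE : Eᵀ = -E) (k l : ι) :
    α E k l = α (Matrix.single k l (1 : ℂ) - Matrix.single l k 1) k l * E k l := by
  -- the linear map behind `α`
  let αℓ : Matrix ι ι ℂ →ₗ[ℂ] Matrix ι ι ℂ := { toFun := α, map_add' := hadd, map_smul' := hsmul }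
  have hαℓ : ∀ W, αℓ W = α W := fun W => rfl
  have hdiag : ∀ W (i : ι), α W i i = 0 := fun W i => by
    have h1 := congrFun (congrFun (hskew W) i) i
    rw [Matrix.transpose_apply, Matrix.neg_apply] at h1
    linear_combination h1 / 2
  by_cases hkl : k = l
  · subst hkl
    rw [hdiag, hdiag, zero_mul]
  -- expand `E` against the wedges and apply `α`
  have hexp : α E = (1 / 2 : ℂ) • ∑ p : ι × ι,
      E p.1 p.2 • α (Matrix.single p.1 p.2 (1 : ℂ) - Matrix.single p.2 p.1 1) := by
    conv_lhs => rw [skew_eq_half_sum_wedge hE]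
    rw [← hαℓ, map_smul, map_sum]
    simp_rw [map_smul, hαℓ]
  -- the entry `(k,l)` of `α(E_ab − E_ba)` vanishes unless `(a,b) ∈ {(k,l),(l,k)}`
  have hvan : ∀ p : ι × ι, p ≠ (k, l) → p ≠ (l, k) →
      α (Matrix.single p.1 p.2 (1 : ℂ) - Matrix.single p.2 p.1 1) k l = 0 := by
    intro p hp1 hp2
    by_cases hp : p.1 = p.2
    · rw [hp, sub_self, ← zero_smul ℂ (0 : Matrix ι ι ℂ), hsmul, zero_smul, Matrix.zero_apply]
    by_cases hk : k = p.1 ∨ k = p.2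
    · -- then `l ∉ {p.1, p.2}` (else `p ∈ {(k,l),(l,k)}`): column `l` vanishes by skew-symmetry
      have hl1 : l ≠ p.1 := by
        rintro rfl
        rcases hk with hk | hk
        · exact hkl hk
        · exact hp2 (Prod.ext rfl hk.symm)
      have hl2 : l ≠ p.2 := by
        rintro rfl
        rcases hk with hk | hk
        · exact hp1 (Prod.ext hk.symm rfl)
        · exact hkl hk
      have h1 := congrFun (congrFun (hskew (Matrix.single p.1 p.2 (1 : ℂ) - Matrix.single p.2 p.1 1)) l) k
      rw [Matrix.transpose_apply, Matrix.neg_apply, hrow p.1 p.2 l hp hl1 hl2 k, neg_zero] at h1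
      exact h1
    · rw [not_or] at hk
      exact hrow p.1 p.2 k hp hk.1 hk.2 l
  have hlk : E l k = -E k l := by
    have h1 := congrFun (congrFun hE k) l
    rwa [Matrix.transpose_apply, Matrix.neg_apply] at h1
  have hneg : α (Matrix.single l k (1 : ℂ) - Matrix.single k l 1) k l =
      -α (Matrix.single k l (1 : ℂ) - Matrix.single l k 1) k l := by
    rw [← Matrix.neg_apply, ← neg_one_smul ℂ (α _), ← hsmul, neg_one_smul, neg_sub]
  rw [hexp, Matrix.smul_apply, Matrix.sum_apply]
  simp only [Matrix.smul_apply, smul_eq_mul]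
  have hlk' : (l, k) ≠ (k, l) := fun h => hkl (Prod.mk.inj h).2
  rw [Finset.sum_eq_add (k, l) (l, k) (Ne.symm hlk') (fun p _ hp => by rw [hvan p hp.1 hp.2, mul_zero])
    (fun h => absurd (Finset.mem_univ _) h) (fun h => absurd (Finset.mem_univ _) h)]
  simp only [hlk, hneg]
  ring

end Small

/-! ### The padded points: skew-symmetry -/

section Pad

variable {m : ℕ}

/-- `R_r(−Ω) = −R_r(Ω)`. [cite: LandsbergManivelRessayre2013, §3.5 (p. 481)] -/
theorem padAt_neg {R : Type*} [CommRing R] (r : Fin (m + 1)) (Ω : Matrix (Fin m) (Fin m) R) :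
    padAt r (-Ω) = -padAt r Ω := by
  ext i j
  rcases Fin.eq_self_or_eq_succAbove r i with hi | ⟨i', hi⟩
  · rw [hi]; simp
  · rcases Fin.eq_self_or_eq_succAbove r j with hj | ⟨j', hj⟩
    · rw [hj]; simp
    · rw [hi, hj]; simp

/-- `R_r(Ω)` is skew-symmetric when `Ω` is. [cite: LandsbergManivelRessayre2013, §3.5 (p. 481)] -/
theorem padAt_transpose_of_skew {R : Type*} [CommRing R] (r : Fin (m + 1)) {Ω : Matrix (Fin m) (Fin m) R}
    (hΩ : Ωᵀ = -Ω) : (padAt r Ω)ᵀ = -padAt r Ω := by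
  rw [padAt_transpose, hΩ, padAt_neg]

/-- `tr(adj(R_rΩ)·M) = det Ω · M_rr`. [cite: LandsbergManivelRessayre2013, §3.5 (p. 481)] -/
theorem trace_adjugate_padAt_mul (r : Fin (m + 1)) (Ω : Matrix (Fin m) (Fin m) ℂ)
    (M : Matrix (Fin (m + 1)) (Fin (m + 1)) ℂ) :
    Matrix.trace ((padAt r Ω).adjugate * M) = Ω.det * M r r := by
  rw [adjugate_padAt, Matrix.smul_mul, Matrix.trace_smul, Matrix.trace_single_mul, smul_eq_mul, smul_eq_mul,
    one_mul]

end Pad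

/-! ### Block (III), abstract form: `(α, β)` with the identity (III) and `Φ = 0` -/

section BlockIII

variable {h : ℕ}

/-- **Row `r` of `α(R_rΩ)` vanishes** (`Ω` invertible skew of size `h+h`): test (III) with `S = E_rk + E_kr`; the
`Φ`-term `det Ω·β(S)_{rr}` vanishes, so `D(R_rΩ, αR_rΩ)_{rk} = 0` for `k ≠ r`, and the row formula
`D(R_rΩ,B)_{r,·}·Ω = −det Ω·B_{r,·}` gives `α(R_rΩ)_{r,·} = 0`. [cite: LandsbergManivelRessayre2013, §3.5 (p. 481)] -/
theorem blockIII_row_padAt_eq_zero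
    (α β : Matrix (Fin (h + h + 1)) (Fin (h + h + 1)) ℂ → Matrix (Fin (h + h + 1)) (Fin (h + h + 1)) ℂ)
    (hαskew : ∀ W, (α W)ᵀ = -α W)
    (hIII : ∀ A S, Aᵀ = -A → Sᵀ = S →
      Matrix.trace (A.adjugate * β S) + Matrix.trace (adjDeriv A (α A) * S) = 0)
    (hΦ : ∀ r a : Fin (h + h + 1), r ≠ a → β (Matrix.single r a (1 : ℂ) + Matrix.single a r 1) r r = 0)
    (r : Fin (h + h + 1)) {Ω : Matrix (Fin (h + h)) (Fin (h + h)) ℂ} (hΩ : Ωᵀ = -Ω) (hΩu : IsUnit Ω.det)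
    (j : Fin (h + h + 1)) : α (padAt r Ω) r j = 0 := by
  have hm : Odd (h + h + 1) := ⟨h, by ring⟩
  have hcard : Odd (Fintype.card (Fin (h + h + 1))) := by rw [Fintype.card_fin]; exact hm
  have hR : (padAt r Ω)ᵀ = -padAt r Ω := padAt_transpose_of_skew r hΩ
  set D := adjDeriv (padAt r Ω) (α (padAt r Ω)) with hD
  have hDsym : Dᵀ = D := adjDeriv_transpose hcard hR (hαskew _)
  -- the off-`r` entries of row `r` of `D` vanish
  have hDrow : ∀ k : Fin (h + h), D r (r.succAbove k) = 0 := by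
    intro k
    have hne : r ≠ r.succAbove k := (Fin.succAbove_ne r k).symm
    have h1 := hIII (padAt r Ω) (Matrix.single r (r.succAbove k) (1 : ℂ) + Matrix.single (r.succAbove k) r 1) hR
      (by rw [Matrix.transpose_add, Matrix.transpose_single, Matrix.transpose_single]; exact add_comm _ _)
    rw [trace_adjugate_padAt_mul, hΦ r _ hne, mul_zero, zero_add, ← hD, Matrix.mul_add, Matrix.trace_add,
      trace_mul_single_one, trace_mul_single_one] at h1
    have hsym : D (r.succAbove k) r = D r (r.succAbove k) := by
      rw [← Matrix.transpose_apply D r (r.succAbove k), hDsym]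
    rw [hsym, ← two_mul, mul_eq_zero] at h1
    exact h1.resolve_left two_ne_zero
  rcases Fin.eq_self_or_eq_succAbove r j with hj | ⟨j', hj⟩
  · rw [hj]
    have h1 := congrFun (congrFun (hαskew (padAt r Ω)) r) r
    rw [Matrix.transpose_apply, Matrix.neg_apply] at h1
    linear_combination h1 / 2
  · rw [hj]
    have h1 := congrFun (adjDeriv_padAt_row_vecMul hm r hΩ (hαskew (padAt r Ω))) j'
    rw [← hD] at h1
    have h0 : (fun k => D r (r.succAbove k)) = 0 := funext fun k => hDrow k
    rw [h0, Matrix.zero_vecMul] at h1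
    simp only [Pi.zero_apply] at h1
    have h2 : Ω.det * α (padAt r Ω) r (r.succAbove j') = 0 := by linear_combination h1
    exact (mul_eq_zero.1 h2).resolve_left hΩu.ne_zero

/-- **Rows `r ∉ {a,b}` of `α(e_a∧e_b)` vanish** (pair-differences of the signed matching matrices `J(π,s)`,
`pairMat_bumpWeight_sub`). [cite: LandsbergManivelRessayre2013, §3.5 (p. 481)] -/
theorem blockIII_row_wedge_eq_zero
    (α β : Matrix (Fin (h + h + 1)) (Fin (h + h + 1)) ℂ → Matrix (Fin (h + h + 1)) (Fin (h + h + 1)) ℂ)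
    (hαadd : ∀ S T, α (S + T) = α S + α T) (hαsmul : ∀ (c : ℂ) S, α (c • S) = c • α S)
    (hαskew : ∀ W, (α W)ᵀ = -α W)
    (hIII : ∀ A S, Aᵀ = -A → Sᵀ = S →
      Matrix.trace (A.adjugate * β S) + Matrix.trace (adjDeriv A (α A) * S) = 0)
    (hΦ : ∀ r a : Fin (h + h + 1), r ≠ a → β (Matrix.single r a (1 : ℂ) + Matrix.single a r 1) r r = 0)
    (r : Fin (h + h + 1)) {a b : Fin (h + h)} (hab : a ≠ b) (j : Fin (h + h + 1)) :
    α (Matrix.single (r.succAbove a) (r.succAbove b) (1 : ℂ) -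
      Matrix.single (r.succAbove b) (r.succAbove a) 1) r j = 0 := by
  have hαsub : ∀ P Q, α (P - Q) = α P - α Q := fun P Q => by
    have h1 := hαadd (P - Q) Q
    rw [sub_add_cancel] at h1
    exact eq_sub_of_add_eq h1.symm
  obtain ⟨π, hπ, hfix, hπa⟩ := exists_involution_apply_eq hab
  set s : Fin (h + h) → ℂ := fun x => if x < π x then (1 : ℂ) else -1 with hs_def
  have hs : ∀ x, s (π x) = -s x := signWeight_antisymm hπ hfix
  have hs0 : ∀ x, s x ≠ 0 := signWeight_ne_zero π
  have e1 := blockIII_row_padAt_eq_zero α β hαskew hIII hΦ r (pairMat_transpose hπ hs)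
    (isUnit_det_pairMat hπ hs hs0) j
  have e2 := blockIII_row_padAt_eq_zero α β hαskew hIII hΦ r
    (pairMat_transpose hπ (bumpWeight_antisymm hπ hs a))
    (isUnit_det_pairMat hπ (bumpWeight_antisymm hπ hs a) (bumpWeight_ne_zero π hs0 a)) j
  have key : α (padAt r (pairMat π (bumpWeight π s a))) - α (padAt r (pairMat π s)) =
      s a • α (Matrix.single (r.succAbove a) (r.succAbove b) (1 : ℂ) -
        Matrix.single (r.succAbove b) (r.succAbove a) 1) := by
    rw [← hαsub, ← padAt_sub, pairMat_bumpWeight_sub hπ hfix hs a, padAt_smul, hαsmul, padAt_sub, padAt_single,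
      padAt_single, hπa]
  have h1 := congrFun (congrFun key r) j
  rw [Matrix.sub_apply, e1, e2, sub_zero, Matrix.smul_apply, smul_eq_mul] at h1
  exact (mul_eq_zero.1 h1.symm).resolve_left (hs0 a)

/-- Rows `r ∉ {a,b}` of `α(e_a∧e_b)` vanish, indices in `Fin (h+h+1)`. [cite: LandsbergManivelRessayre2013, §3.5 (p. 481)] -/
theorem blockIII_row_wedge_eq_zero'
    (α β : Matrix (Fin (h + h + 1)) (Fin (h + h + 1)) ℂ → Matrix (Fin (h + h + 1)) (Fin (h + h + 1)) ℂ)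
    (hαadd : ∀ S T, α (S + T) = α S + α T) (hαsmul : ∀ (c : ℂ) S, α (c • S) = c • α S)
    (hαskew : ∀ W, (α W)ᵀ = -α W)
    (hIII : ∀ A S, Aᵀ = -A → Sᵀ = S →
      Matrix.trace (A.adjugate * β S) + Matrix.trace (adjDeriv A (α A) * S) = 0)
    (hΦ : ∀ r a : Fin (h + h + 1), r ≠ a → β (Matrix.single r a (1 : ℂ) + Matrix.single a r 1) r r = 0)
    (a b r : Fin (h + h + 1)) (hab : a ≠ b) (hra : r ≠ a) (hrb : r ≠ b) (j : Fin (h + h + 1)) :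
    α (Matrix.single a b (1 : ℂ) - Matrix.single b a 1) r j = 0 := by
  obtain ⟨a', rfl⟩ := Fin.exists_succAbove_eq (Ne.symm hra)
  obtain ⟨b', rfl⟩ := Fin.exists_succAbove_eq (Ne.symm hrb)
  have hab' : a' ≠ b' := fun e => hab (by rw [e])
  exact blockIII_row_wedge_eq_zero α β hαadd hαsmul hαskew hIII hΦ r hab' j

/-- **`α` is a Hadamard multiplier on `Λ²`** under (III) and `Φ = 0`: `α(E)_{kl} = a'_{kl}·E_{kl}` for skew `E`,
with `a'_{kl} = α(e_k∧e_l)_{kl}`. [cite: LandsbergManivelRessayre2013, §3.5 (p. 481)] -/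
theorem blockIII_hadamard
    (α β : Matrix (Fin (h + h + 1)) (Fin (h + h + 1)) ℂ → Matrix (Fin (h + h + 1)) (Fin (h + h + 1)) ℂ)
    (hαadd : ∀ S T, α (S + T) = α S + α T) (hαsmul : ∀ (c : ℂ) S, α (c • S) = c • α S)
    (hαskew : ∀ W, (α W)ᵀ = -α W)
    (hIII : ∀ A S, Aᵀ = -A → Sᵀ = S →
      Matrix.trace (A.adjugate * β S) + Matrix.trace (adjDeriv A (α A) * S) = 0)
    (hΦ : ∀ r a : Fin (h + h + 1), r ≠ a → β (Matrix.single r a (1 : ℂ) + Matrix.single a r 1) r r = 0)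
    {E : Matrix (Fin (h + h + 1)) (Fin (h + h + 1)) ℂ} (hE : Eᵀ = -E) (k l : Fin (h + h + 1)) :
    α E k l = α (Matrix.single k l (1 : ℂ) - Matrix.single l k 1) k l * E k l :=
  hadamard_of_rows_eq_zero α hαadd hαsmul hαskew
    (fun a b r hab hra hrb j => blockIII_row_wedge_eq_zero' α β hαadd hαsmul hαskew hIII hΦ a b r hab hra hrb j)
    hE k l

/-- The Hadamard coefficients are symmetric: `a'_{kl} = a'_{lk}`. [cite: LandsbergManivelRessayre2013, §3.5 (p. 481)] -/
theorem wedgeCoeff_symm {ι : Type*} [DecidableEq ι] (α : Matrix ι ι ℂ → Matrix ι ι ℂ)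
    (hsmul : ∀ (c : ℂ) S, α (c • S) = c • α S) (hskew : ∀ W, (α W)ᵀ = -α W) (k l : ι) :
    α (Matrix.single l k (1 : ℂ) - Matrix.single k l 1) l k =
      α (Matrix.single k l (1 : ℂ) - Matrix.single l k 1) k l := by
  have h1 : Matrix.single l k (1 : ℂ) - Matrix.single k l 1 =
      (-1 : ℂ) • (Matrix.single k l (1 : ℂ) - Matrix.single l k 1) := by rw [neg_one_smul, neg_sub]
  have h2 := congrFun (congrFun (hskew (Matrix.single k l (1 : ℂ) - Matrix.single l k 1)) k) l
  rw [Matrix.transpose_apply, Matrix.neg_apply] at h2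
  rw [h1, hsmul, Matrix.smul_apply, smul_eq_mul, h2, neg_one_mul, neg_neg]

/-- **The involution sums**: testing (III) at `R_r(J(π,s))` with `S = E_rr` (Jacobi's formula) gives
`Σ_x a'_{x̄, π̄x} = −β(E_rr)_{rr}` for every fixed-point-free involution `π` of `Fin (h+h)` (bars: `r.succAbove`),
a quantity independent of `π`. [cite: LandsbergManivelRessayre2013, §3.5 (p. 481)] -/
theorem blockIII_sum_pairs_eq
    (α β : Matrix (Fin (h + h + 1)) (Fin (h + h + 1)) ℂ → Matrix (Fin (h + h + 1)) (Fin (h + h + 1)) ℂ)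
    (hαadd : ∀ S T, α (S + T) = α S + α T) (hαsmul : ∀ (c : ℂ) S, α (c • S) = c • α S)
    (hαskew : ∀ W, (α W)ᵀ = -α W)
    (hIII : ∀ A S, Aᵀ = -A → Sᵀ = S →
      Matrix.trace (A.adjugate * β S) + Matrix.trace (adjDeriv A (α A) * S) = 0)
    (hΦ : ∀ r a : Fin (h + h + 1), r ≠ a → β (Matrix.single r a (1 : ℂ) + Matrix.single a r 1) r r = 0)
    (r : Fin (h + h + 1)) {π : Equiv.Perm (Fin (h + h))} (hπ : ∀ x, π (π x) = x) (hfix : ∀ x, π x ≠ x) :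
    ∑ x : Fin (h + h), α (Matrix.single (r.succAbove x) (r.succAbove (π x)) (1 : ℂ) -
        Matrix.single (r.succAbove (π x)) (r.succAbove x) 1) (r.succAbove x) (r.succAbove (π x)) =
      -β (Matrix.single r r 1) r r := by
  set s : Fin (h + h) → ℂ := fun x => if x < π x then (1 : ℂ) else -1 with hs_def
  have hs : ∀ x, s (π x) = -s x := signWeight_antisymm hπ hfix
  have hs0 : ∀ x, s x ≠ 0 := signWeight_ne_zero π
  have hΩ : (pairMat π s)ᵀ = -pairMat π s := pairMat_transpose hπ hs
  have hΩu : IsUnit (pairMat π s).det := isUnit_det_pairMat hπ hs hs0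
  have hR : (padAt r (pairMat π s))ᵀ = -padAt r (pairMat π s) := padAt_transpose_of_skew r hΩ
  -- the Hadamard coefficients along the pairs of `π`
  set a : Fin (h + h) → ℂ := fun x => α (Matrix.single (r.succAbove x) (r.succAbove (π x)) (1 : ℂ) -
    Matrix.single (r.succAbove (π x)) (r.succAbove x) 1) (r.succAbove x) (r.succAbove (π x)) with ha_def
  -- `α(R_r J(π,s)) = R_r J(π, s·a)`
  have hαR : α (padAt r (pairMat π s)) = padAt r (pairMat π fun x => s x * a x) := by
    ext k l
    rw [blockIII_hadamard α β hαadd hαsmul hαskew hIII hΦ hR k l]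
    rcases Fin.eq_self_or_eq_succAbove r k with hk | ⟨k', hk⟩
    · rw [hk, padAt_apply_left, padAt_apply_left, mul_zero]
    · rcases Fin.eq_self_or_eq_succAbove r l with hl | ⟨l', hl⟩
      · rw [hl, padAt_apply_right, padAt_apply_right, mul_zero]
      · rw [hk, hl, padAt_apply_succAbove, padAt_apply_succAbove, pairMat_apply, pairMat_apply]
        by_cases hkl : π k' = l'
        · subst hkl
          rw [if_pos rfl, if_pos rfl, mul_comm]
        · rw [if_neg hkl, if_neg hkl, mul_zero]
  -- (III) at `S = E_rr`
  have h1 := hIII (padAt r (pairMat π s)) (Matrix.single r r 1) hR (Matrix.transpose_single r r 1)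
  rw [trace_adjugate_padAt_mul, trace_mul_single_one, adjDeriv_padAt_apply_self r hΩu, hαR, submatrix_padAt,
    pairMat_inv hπ hs hs0, pairMat_mul_pairMat hπ, Matrix.trace_diagonal, ← mul_add, mul_eq_zero] at h1
  rcases h1 with h1 | h1
  · exact absurd h1 hΩu.ne_zero
  · have hsum : ∑ x : Fin (h + h), -(s x)⁻¹ * (s (π x) * a (π x)) = ∑ x : Fin (h + h), a x := by
      rw [← Equiv.sum_comp π a]
      refine Finset.sum_congr rfl fun x _ => ?_
      rw [hs]
      field_simp [hs0 x]
    rw [hsum] at h1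
    linear_combination h1

/-- **Exchange relation**: for distinct `a, b, c, d` in `Fin (h+h)` (and the base index `r`),
`a'_{āb̄} + a'_{c̄d̄} = a'_{āc̄} + a'_{b̄d̄}` — compare the involution sums of a matching through `{a,b},{c,d}` and
of its exchange through `{a,c},{b,d}`. [cite: LandsbergManivelRessayre2013, §3.5 (p. 481)] -/
theorem blockIII_exchange
    (α β : Matrix (Fin (h + h + 1)) (Fin (h + h + 1)) ℂ → Matrix (Fin (h + h + 1)) (Fin (h + h + 1)) ℂ)
    (hαadd : ∀ S T, α (S + T) = α S + α T) (hαsmul : ∀ (c : ℂ) S, α (c • S) = c • α S)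
    (hαskew : ∀ W, (α W)ᵀ = -α W)
    (hIII : ∀ A S, Aᵀ = -A → Sᵀ = S →
      Matrix.trace (A.adjugate * β S) + Matrix.trace (adjDeriv A (α A) * S) = 0)
    (hΦ : ∀ r a : Fin (h + h + 1), r ≠ a → β (Matrix.single r a (1 : ℂ) + Matrix.single a r 1) r r = 0)
    (r : Fin (h + h + 1)) {a b c d : Fin (h + h)} (hab : a ≠ b) (hcd : c ≠ d) (hac : a ≠ c) (had : a ≠ d)
    (hbc : b ≠ c) (hbd : b ≠ d) :
    α (Matrix.single (r.succAbove a) (r.succAbove b) (1 : ℂ) -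
        Matrix.single (r.succAbove b) (r.succAbove a) 1) (r.succAbove a) (r.succAbove b) +
      α (Matrix.single (r.succAbove c) (r.succAbove d) (1 : ℂ) -
        Matrix.single (r.succAbove d) (r.succAbove c) 1) (r.succAbove c) (r.succAbove d) =
    α (Matrix.single (r.succAbove a) (r.succAbove c) (1 : ℂ) -
        Matrix.single (r.succAbove c) (r.succAbove a) 1) (r.succAbove a) (r.succAbove c) +
      α (Matrix.single (r.succAbove b) (r.succAbove d) (1 : ℂ) -
        Matrix.single (r.succAbove d) (r.succAbove b) 1) (r.succAbove b) (r.succAbove d) := by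
  -- the coefficient function on `Fin (h+h) × Fin (h+h)` and its symmetry
  set A : Fin (h + h) → Fin (h + h) → ℂ := fun x y => α (Matrix.single (r.succAbove x) (r.succAbove y) (1 : ℂ) -
    Matrix.single (r.succAbove y) (r.succAbove x) 1) (r.succAbove x) (r.succAbove y) with hA_def
  have hAsymm : ∀ x y, A y x = A x y := fun x y => wedgeCoeff_symm α hαsmul hαskew _ _
  -- a matching through `{a,b},{c,d}` and its exchange
  obtain ⟨π, hπ, hfix, hπa, hπc⟩ := exists_involution_apply_eq_apply_eq hab hcd hac.symm hbc.symm had.symm hbd.symm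
  obtain ⟨hπ', hfix', hπ'a, hπ'b, hπ'off⟩ := exchange_involution hπ hfix hπa hπc hac hbd
  set π' := Equiv.swap b c * π * Equiv.swap b c with hπ'_def
  have hπb : π b = a := by rw [← hπa, hπ]
  have hπd : π d = c := by rw [← hπc, hπ]
  have hπ'c : π' c = a := by rw [← hπ'a, hπ']
  have hπ'd : π' d = b := by rw [← hπ'b, hπ']
  have e1 := blockIII_sum_pairs_eq α β hαadd hαsmul hαskew hIII hΦ r hπ hfix
  have e2 := blockIII_sum_pairs_eq α β hαadd hαsmul hαskew hIII hΦ r hπ' hfix'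
  -- the difference of the two involution sums is supported on `{a,b,c,d}`
  have hdiff : ∑ x : Fin (h + h), (A x (π x) - A x (π' x)) = 0 := by
    rw [Finset.sum_sub_distrib]
    change (∑ x, A x (π x)) - (∑ x, A x (π' x)) = 0
    rw [e1, e2, sub_self]
  have hsupp : ∀ x, x ∉ ({a, b, c, d} : Finset (Fin (h + h))) → A x (π x) - A x (π' x) = 0 := by
    intro x hx
    simp only [Finset.mem_insert, Finset.mem_singleton, not_or] at hx
    rw [hπ'off x hx.1 hx.2.1 hx.2.2.1 hx.2.2.2, sub_self]
  rw [← Finset.sum_subset (Finset.subset_univ ({a, b, c, d} : Finset (Fin (h + h))))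
    (fun x _ hx => hsupp x hx)] at hdiff
  rw [Finset.sum_insert (by simp [hab, hac, had]), Finset.sum_insert (by simp [hbc, hbd]),
    Finset.sum_insert (by simp [hcd]), Finset.sum_singleton, hπa, hπb, hπc, hπd, hπ'a, hπ'b, hπ'c, hπ'd,
    hAsymm a b, hAsymm c d, hAsymm a c, hAsymm b d] at hdiff
  linear_combination hdiff / 2

/-- **Block (III), abstract form.** If `α` (additive, homogeneous, skew-valued) and `β` satisfy the identity
(III) for all skew `A` and symmetric `S`, the functionals `Φ_{ra} = β(E_ra + E_ar)_{rr}` vanish, and the `n`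
functionals `Ψ` (`a'_{0j}`, `j ≠ 0`, and `a'_{12}`) vanish, then `α(A) = 0` for every skew `A` (`n = h+h+1 ≥ 5`).
[cite: LandsbergManivelRessayre2013, §3.5 (p. 481)] -/
theorem blockIII_skewPart_eq_zero (h2 : 2 ≤ h)
    (α β : Matrix (Fin (h + h + 1)) (Fin (h + h + 1)) ℂ → Matrix (Fin (h + h + 1)) (Fin (h + h + 1)) ℂ)
    (hαadd : ∀ S T, α (S + T) = α S + α T) (hαsmul : ∀ (c : ℂ) S, α (c • S) = c • α S)
    (hαskew : ∀ W, (α W)ᵀ = -α W)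
    (hIII : ∀ A S, Aᵀ = -A → Sᵀ = S →
      Matrix.trace (A.adjugate * β S) + Matrix.trace (adjDeriv A (α A) * S) = 0)
    (hΦ : ∀ r a : Fin (h + h + 1), r ≠ a → β (Matrix.single r a (1 : ℂ) + Matrix.single a r 1) r r = 0)
    (hΨ : ∀ j : Fin (h + h + 1), j ≠ 0 → α (Matrix.single 0 j (1 : ℂ) - Matrix.single j 0 1) 0 j = 0)
    (hΨ12 : α (Matrix.single (⟨1, by omega⟩ : Fin (h + h + 1)) (⟨2, by omega⟩ : Fin (h + h + 1)) (1 : ℂ) -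
      Matrix.single (⟨2, by omega⟩ : Fin (h + h + 1)) (⟨1, by omega⟩ : Fin (h + h + 1)) 1)
      (⟨1, by omega⟩ : Fin (h + h + 1)) (⟨2, by omega⟩ : Fin (h + h + 1)) = 0)
    {A : Matrix (Fin (h + h + 1)) (Fin (h + h + 1)) ℂ} (hA : Aᵀ = -A) : α A = 0 := by
  -- the coefficients `a'` on `Fin (h+h+1)`
  set a' : Fin (h + h + 1) → Fin (h + h + 1) → ℂ := fun x y =>
    α (Matrix.single x y (1 : ℂ) - Matrix.single y x 1) x y with ha'_def
  have hsymm : ∀ x y, a' y x = a' x y := fun x y => wedgeCoeff_symm α hαsmul hαskew x y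
  -- exchange relations among five distinct indices of `Fin (h+h+1)`
  have hexch : ∀ x y z w : Fin (h + h + 1), x ≠ y → z ≠ w → x ≠ z → x ≠ w → y ≠ z → y ≠ w →
      a' x y + a' z w = a' x z + a' y w := by
    intro x y z w hxy hzw hxz hxw hyz hyw
    obtain ⟨r, -, hr⟩ := Finset.exists_mem_notMem_of_card_lt_card
      (s := ({x, y, z, w} : Finset (Fin (h + h + 1)))) (t := (Finset.univ : Finset (Fin (h + h + 1))))
      (calc ({x, y, z, w} : Finset (Fin (h + h + 1))).card ≤ 4 := Finset.card_le_four
        _ < (Finset.univ : Finset (Fin (h + h + 1))).card := by rw [Finset.card_univ, Fintype.card_fin]; omega)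
    simp only [Finset.mem_insert, Finset.mem_singleton, not_or] at hr
    obtain ⟨x', rfl⟩ := Fin.exists_succAbove_eq (Ne.symm hr.1)
    obtain ⟨y', rfl⟩ := Fin.exists_succAbove_eq (Ne.symm hr.2.1)
    obtain ⟨z', rfl⟩ := Fin.exists_succAbove_eq (Ne.symm hr.2.2.1)
    obtain ⟨w', rfl⟩ := Fin.exists_succAbove_eq (Ne.symm hr.2.2.2)
    exact blockIII_exchange α β hαadd hαsmul hαskew hIII hΦ r (fun e => hxy (by rw [e])) (fun e => hzw (by rw [e]))
      (fun e => hxz (by rw [e])) (fun e => hxw (by rw [e])) (fun e => hyz (by rw [e])) (fun e => hyw (by rw [e]))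
  -- the indices `0, 1, 2`
  set i1 : Fin (h + h + 1) := ⟨1, by omega⟩ with hi1
  set i2 : Fin (h + h + 1) := ⟨2, by omega⟩ with hi2
  have h10 : i1 ≠ 0 := by simp [hi1, Fin.ext_iff]
  have h20 : i2 ≠ 0 := by simp [hi2, Fin.ext_iff]
  have h12 : i1 ≠ i2 := by simp [hi1, hi2, Fin.ext_iff]
  -- step 1: `a'_{cd} = a'_{bd}` for distinct non-zero `b, c, d`
  have step1 : ∀ b c d : Fin (h + h + 1), b ≠ 0 → c ≠ 0 → d ≠ 0 → b ≠ c → b ≠ d → c ≠ d →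
      a' c d = a' b d := by
    intro b c d hb hc hd hbc hbd hcd
    have e := hexch 0 b c d hb.symm hcd hc.symm hd.symm hbc hbd
    have e1 : a' 0 b = 0 := hΨ b hb
    have e2 : a' 0 c = 0 := hΨ c hc
    rw [e1, e2, zero_add, zero_add] at e
    exact e
  -- step 2: the column of `1`
  have hx1 : ∀ x : Fin (h + h + 1), x ≠ 0 → x ≠ i1 → a' x i1 = 0 := by
    intro x hx0 hx1
    by_cases hx2 : x = i2
    · rw [hx2, hsymm]
      exact hΨ12
    · rw [step1 i2 x i1 h20 hx0 h10 (Ne.symm hx2) h12.symm hx1, hsymm]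
      exact hΨ12
  -- step 3: all off-diagonal coefficients vanish
  have hoff : ∀ x y : Fin (h + h + 1), x ≠ y → a' x y = 0 := by
    intro x y hxy
    by_cases hx0 : x = 0
    · subst hx0
      exact hΨ y (Ne.symm hxy)
    by_cases hy0 : y = 0
    · rw [hy0, hsymm]
      exact hΨ x hx0
    by_cases hy1 : y = i1
    · rw [hy1]
      exact hx1 x hx0 (hy1 ▸ hxy)
    by_cases hx1' : x = i1
    · rw [hx1', hsymm]
      exact hx1 y hy0 hy1
    · rw [step1 i1 x y h10 hx0 hy0 (Ne.symm hx1') (Ne.symm hy1) hxy, hsymm]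
      exact hx1 y hy0 hy1
  -- conclude by the Hadamard form
  ext k l
  rw [blockIII_hadamard α β hαadd hαsmul hαskew hIII hΦ hA k l, Matrix.zero_apply]
  by_cases hkl : k = l
  · subst hkl
    have h1 := congrFun (congrFun hA k) k
    rw [Matrix.transpose_apply, Matrix.neg_apply] at h1
    have hkk : A k k = 0 := by linear_combination h1 / 2
    rw [hkk, mul_zero]
  · have h1 := hoff k l hkl
    simp only [ha'_def] at h1
    rw [h1, zero_mul]

/-- Consequence for the `β`-half: once `α = 0` on `Λ²`, (III) says that `β(S)` is trace-orthogonal to the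
adjugate of every skew matrix. [cite: LandsbergManivelRessayre2013, §3.5 (p. 481)] -/
theorem blockIII_trace_adjugate_mul_eq_zero (h2 : 2 ≤ h)
    (α β : Matrix (Fin (h + h + 1)) (Fin (h + h + 1)) ℂ → Matrix (Fin (h + h + 1)) (Fin (h + h + 1)) ℂ)
    (hαadd : ∀ S T, α (S + T) = α S + α T) (hαsmul : ∀ (c : ℂ) S, α (c • S) = c • α S)
    (hαskew : ∀ W, (α W)ᵀ = -α W)
    (hIII : ∀ A S, Aᵀ = -A → Sᵀ = S →
      Matrix.trace (A.adjugate * β S) + Matrix.trace (adjDeriv A (α A) * S) = 0)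
    (hΦ : ∀ r a : Fin (h + h + 1), r ≠ a → β (Matrix.single r a (1 : ℂ) + Matrix.single a r 1) r r = 0)
    (hΨ : ∀ j : Fin (h + h + 1), j ≠ 0 → α (Matrix.single 0 j (1 : ℂ) - Matrix.single j 0 1) 0 j = 0)
    (hΨ12 : α (Matrix.single (⟨1, by omega⟩ : Fin (h + h + 1)) (⟨2, by omega⟩ : Fin (h + h + 1)) (1 : ℂ) -
      Matrix.single (⟨2, by omega⟩ : Fin (h + h + 1)) (⟨1, by omega⟩ : Fin (h + h + 1)) 1)
      (⟨1, by omega⟩ : Fin (h + h + 1)) (⟨2, by omega⟩ : Fin (h + h + 1)) = 0)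
    {A S : Matrix (Fin (h + h + 1)) (Fin (h + h + 1)) ℂ} (hA : Aᵀ = -A) (hS : Sᵀ = S) :
    Matrix.trace (A.adjugate * β S) = 0 := by
  have h1 := hIII A S hA hS
  rwa [blockIII_skewPart_eq_zero h2 α β hαadd hαsmul hαskew hIII hΦ hΨ hΨ12 hA, adjDeriv_zero, Matrix.zero_mul,
    Matrix.trace_zero, add_zero] at h1

end BlockIII

/-! ### Block (III) for `X ∈ glAnn (pLambda (h+h+1))` in the cell's interface -/

section Concrete

variable {h : ℕ}

/-- **Block (III) of the elementary route (the cell's §F interface).** For `X ∈ 𝔤𝔩(W)_{P_Λ}`, `n = h+h+1 ≥ 5`,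
write `(L_X W)_{kl} = Σ_p X_{p,(k,l)} W_p`. If the `n(n−1)` functionals `Φ_{ra} = (L_X(E_ra + E_ar))_{rr}`
(`r ≠ a`) and the `n` functionals `Ψ_j = (L_X(E_0j − E_j0))_{0j} − (L_X(E_0j − E_j0))_{j0}` (`j ≠ 0`),
`Ψ_12 = (L_X(E_12 − E_21))_{12} − (L_X(E_12 − E_21))_{21}` vanish at `X`, then the skew part of `L_X A` vanishes
for every skew `A`. [cite: LandsbergManivelRessayre2013, §3.5 (p. 481)] -/
theorem skewPart_linAct_skew_eq_zero (h2 : 2 ≤ h)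
    {X : Matrix (Fin (h + h + 1) × Fin (h + h + 1)) (Fin (h + h + 1) × Fin (h + h + 1)) ℂ}
    (hX : X ∈ glAnn (pLambda (h + h + 1)))
    (hΦ : ∀ r a : Fin (h + h + 1), r ≠ a →
      (Matrix.of fun k l => ∑ p : Fin (h + h + 1) × Fin (h + h + 1),
        X p (k, l) * (Matrix.single r a (1 : ℂ) + Matrix.single a r (1 : ℂ)) p.1 p.2) r r = 0)
    (hΨ : ∀ j : Fin (h + h + 1), j ≠ 0 →
      (Matrix.of fun k l => ∑ p : Fin (h + h + 1) × Fin (h + h + 1),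
          X p (k, l) * (Matrix.single (0 : Fin (h + h + 1)) j (1 : ℂ) - Matrix.single j (0 : Fin (h + h + 1)) (1 : ℂ)) p.1 p.2) 0 j -
        (Matrix.of fun k l => ∑ p : Fin (h + h + 1) × Fin (h + h + 1),
          X p (k, l) * (Matrix.single (0 : Fin (h + h + 1)) j (1 : ℂ) - Matrix.single j (0 : Fin (h + h + 1)) (1 : ℂ)) p.1 p.2) j 0 = 0)
    (hΨ12 :
      (Matrix.of fun k l => ∑ p : Fin (h + h + 1) × Fin (h + h + 1), X p (k, l) *
            (Matrix.single (⟨1, by omega⟩ : Fin (h + h + 1)) (⟨2, by omega⟩ : Fin (h + h + 1)) (1 : ℂ) -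
              Matrix.single (⟨2, by omega⟩ : Fin (h + h + 1)) (⟨1, by omega⟩ : Fin (h + h + 1)) (1 : ℂ)) p.1 p.2)
            (⟨1, by omega⟩ : Fin (h + h + 1)) (⟨2, by omega⟩ : Fin (h + h + 1)) -
        (Matrix.of fun k l => ∑ p : Fin (h + h + 1) × Fin (h + h + 1), X p (k, l) *
            (Matrix.single (⟨1, by omega⟩ : Fin (h + h + 1)) (⟨2, by omega⟩ : Fin (h + h + 1)) (1 : ℂ) -
              Matrix.single (⟨2, by omega⟩ : Fin (h + h + 1)) (⟨1, by omega⟩ : Fin (h + h + 1)) (1 : ℂ)) p.1 p.2)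
            (⟨2, by omega⟩ : Fin (h + h + 1)) (⟨1, by omega⟩ : Fin (h + h + 1)) = 0)
    {A : Matrix (Fin (h + h + 1)) (Fin (h + h + 1)) ℂ} (hA : Aᵀ = -A) :
    (1 / 2 : ℂ) • ((Matrix.of fun k l => ∑ p : Fin (h + h + 1) × Fin (h + h + 1), X p (k, l) * A p.1 p.2) -
      (Matrix.of fun k l => ∑ p : Fin (h + h + 1) × Fin (h + h + 1), X p (k, l) * A p.1 p.2)ᵀ) = 0 := by
  refine blockIII_skewPart_eq_zero h2
    (fun W => (1 / 2 : ℂ) •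
      ((Matrix.of fun k l => ∑ p : Fin (h + h + 1) × Fin (h + h + 1), X p (k, l) * W p.1 p.2) -
        (Matrix.of fun k l => ∑ p : Fin (h + h + 1) × Fin (h + h + 1), X p (k, l) * W p.1 p.2)ᵀ))
    (fun W => (1 / 2 : ℂ) •
      ((Matrix.of fun k l => ∑ p : Fin (h + h + 1) × Fin (h + h + 1), X p (k, l) * W p.1 p.2) +
        (Matrix.of fun k l => ∑ p : Fin (h + h + 1) × Fin (h + h + 1), X p (k, l) * W p.1 p.2)ᵀ))
    ?_ ?_ ?_ ?_ ?_ ?_ ?_ hA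
  · intro S T
    rw [linAct_add, Matrix.transpose_add, ← smul_add]
    congr 1
    abel
  · intro c S
    rw [linAct_smul, Matrix.transpose_smul, ← smul_sub, smul_comm]
  · intro W
    exact transpose_half_smul_sub_transpose _
  · intro A S hA hS
    exact (pLambda_glAnn_blocks (Nat.succ_ne_zero _) hX hA hS).2.1
  · intro r a hra
    rw [Matrix.smul_apply, Matrix.add_apply, Matrix.transpose_apply, hΦ r a hra, add_zero, smul_zero]
  · intro j hj
    rw [Matrix.smul_apply, Matrix.sub_apply, Matrix.transpose_apply, hΨ j hj, smul_zero]
  · rw [Matrix.smul_apply, Matrix.sub_apply, Matrix.transpose_apply, hΨ12, smul_zero]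

/-- **Towards the `β`-half.** Under the same hypotheses, the symmetric part of `L_X S` is trace-orthogonal to
`adj(A)` for every skew `A` and symmetric `S` (then `β = 0` follows from the rank-one adjugates `det Ω·yyᵀ`).
[cite: LandsbergManivelRessayre2013, §3.5 (p. 481)] -/
theorem trace_adjugate_mul_symPart_linAct_eq_zero_of_blockIII (h2 : 2 ≤ h)
    {X : Matrix (Fin (h + h + 1) × Fin (h + h + 1)) (Fin (h + h + 1) × Fin (h + h + 1)) ℂ}
    (hX : X ∈ glAnn (pLambda (h + h + 1)))
    (hΦ : ∀ r a : Fin (h + h + 1), r ≠ a →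
      (Matrix.of fun k l => ∑ p : Fin (h + h + 1) × Fin (h + h + 1),
        X p (k, l) * (Matrix.single r a (1 : ℂ) + Matrix.single a r (1 : ℂ)) p.1 p.2) r r = 0)
    (hΨ : ∀ j : Fin (h + h + 1), j ≠ 0 →
      (Matrix.of fun k l => ∑ p : Fin (h + h + 1) × Fin (h + h + 1),
          X p (k, l) * (Matrix.single (0 : Fin (h + h + 1)) j (1 : ℂ) - Matrix.single j (0 : Fin (h + h + 1)) (1 : ℂ)) p.1 p.2) 0 j -
        (Matrix.of fun k l => ∑ p : Fin (h + h + 1) × Fin (h + h + 1),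
          X p (k, l) * (Matrix.single (0 : Fin (h + h + 1)) j (1 : ℂ) - Matrix.single j (0 : Fin (h + h + 1)) (1 : ℂ)) p.1 p.2) j 0 = 0)
    (hΨ12 :
      (Matrix.of fun k l => ∑ p : Fin (h + h + 1) × Fin (h + h + 1), X p (k, l) *
            (Matrix.single (⟨1, by omega⟩ : Fin (h + h + 1)) (⟨2, by omega⟩ : Fin (h + h + 1)) (1 : ℂ) -
              Matrix.single (⟨2, by omega⟩ : Fin (h + h + 1)) (⟨1, by omega⟩ : Fin (h + h + 1)) (1 : ℂ)) p.1 p.2)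
            (⟨1, by omega⟩ : Fin (h + h + 1)) (⟨2, by omega⟩ : Fin (h + h + 1)) -
        (Matrix.of fun k l => ∑ p : Fin (h + h + 1) × Fin (h + h + 1), X p (k, l) *
            (Matrix.single (⟨1, by omega⟩ : Fin (h + h + 1)) (⟨2, by omega⟩ : Fin (h + h + 1)) (1 : ℂ) -
              Matrix.single (⟨2, by omega⟩ : Fin (h + h + 1)) (⟨1, by omega⟩ : Fin (h + h + 1)) (1 : ℂ)) p.1 p.2)
            (⟨2, by omega⟩ : Fin (h + h + 1)) (⟨1, by omega⟩ : Fin (h + h + 1)) = 0)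
    {A S : Matrix (Fin (h + h + 1)) (Fin (h + h + 1)) ℂ} (hA : Aᵀ = -A) (hS : Sᵀ = S) :
    Matrix.trace (A.adjugate * ((1 / 2 : ℂ) •
      ((Matrix.of fun k l => ∑ p : Fin (h + h + 1) × Fin (h + h + 1), X p (k, l) * S p.1 p.2) +
        (Matrix.of fun k l => ∑ p : Fin (h + h + 1) × Fin (h + h + 1), X p (k, l) * S p.1 p.2)ᵀ))) = 0 := by
  have h1 := (pLambda_glAnn_blocks (Nat.succ_ne_zero _) hX hA hS).2.1
  rwa [skewPart_linAct_skew_eq_zero h2 hX hΦ hΨ hΨ12 hA, adjDeriv_zero, Matrix.zero_mul,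
    Matrix.trace_zero, add_zero] at h1

end Concrete

end SkewAdj

end Literature.Computability.AlgebraicComplexity

end
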